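import Literature.Probability.RandomPlanarGeometry.SAWEndpointDelocalization
import Literature.Probability.RandomPlanarGeometry.SAWUnfoldingStep
import Literature.Probability.RandomPlanarGeometry.SAWSubBallisticFromBridges
import HarnessLib

/-!
# `P_{SAW_n}(‖Γ_n‖ = 1) ≤ 2/3` for `n ≥ 3^d + 1` (Duminil-Copin–Glazman–Hammond–Manolescu 2016, §2.3)

Topic `Literature/Probability/RandomPlanarGeometry` (continues `SAWEndpointDelocalization.lean`: the
event `closingWalks d n` = the `n`-step self-avoiding walks from `0` on `ℤ^d` whose endpoint is a
nearest neighbour of the origin, and the OPEN named facts `Zd.DGHM2016_thm1_1` (`≤ n^{-1/4+ε}`) /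
`Zd.DGHM2016_thm1_2`; `SAWUnfoldingStep.lean`: the Hammersley–Welsh unfolding step `Zd.unfoldStep`
at the last maximum of the first coordinate, with its decoder `Zd.undoStep_unfoldStep`;
`SAWSubBallisticFromBridges.lean`: the hyperoctahedral symmetries `Zd.signSwapWalk_mem_saws`).

Source: H. Duminil-Copin, A. Glazman, A. Hammond, I. Manolescu, *On the probability that
self-avoiding walk ends at a given point*, Ann. Probab. **44** (2016) 955–983, arXiv:1305.1257, §2.3
"Unfolding self-avoiding walks" (held LaTeX text `paper:arxiv-1305.1257`, chunk p0005), AS PRINTED: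

* L64–L72: "For `γ ∈ SAW_n`, let `k` be any index such that `⟨γ_k | e_1⟩ = max{⟨γ_j | e_1⟩ : 0 ≤ j ≤ n}`.
  The simplest unfoldings of `γ` are those walks obtained by concatenating `γ[0,k]` and
  `Rfl_{γ_k}(γ[k,n])` for such an index `k`. The condition on `k` ensures that any such walk is indeed
  self-avoiding."
* L96–L114: "In [Madras12], Madras used an unfolding argument to obtain a lower bound on the
  mean-square displacement of a uniform self-avoiding walk. A simple adaptation of his technique
  proves that **`P_{SAW_n}(‖Γ_n‖ = 1) ≤ 2/3` for all `n ≥ 3^d + 1`**. … To any walk `γ ∈ SAW_n` with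
  `‖γ_n‖ = 1`, choose an axial direction in which `γ` has maximal coordinate at least two – we will
  assume this to be the `e_1`-direction – and associate to `γ` its simple unfolding `b ∈ SAW_n`, given
  by concatenating the `e_1`-reflection of `γ^2` to `γ^1`. Any unfolded walk `b` corresponds to at most
  two walks `γ` with `‖γ_n‖ = 1`. This is because the level at which the unfolding was done is one
  among `(⟨b_n | e_1⟩ - 1)/2`, `⟨b_n | e_1⟩/2` and `(⟨b_n | e_1⟩ + 1)/2`, of which at most two are
  integers. Moreover, since the maximal `e_1`-coordinate of `γ` is at least two, the unfolding of `γ`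
  is such that `‖b_n‖ > 1`. The choice of axial direction for reflection may be made in such a way
  that it may be determined from the unfolded walk. Thus, `P_{SAW_n}(‖Γ_n‖ = 1) ≤ 2/3`."

(`[Madras12]` = N. Madras, *A lower bound for the end-to-end distance of the self-avoiding walk*,
Canad. Math. Bull. **57** (2014) 113–118 — bib `Madras2014`, tree `SAWEndToEndLowerBound.lean`.)

## What is proved (namespace `Literature.Probability.RandomPlanarGeometry.SAW.Zd`; all `theorem`s, no facts)

For every `d ≥ 1` (`[NeZero d]`; the source has `d ≥ 2`) and every `n ≥ 3^d + 1`: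

* **`DGHM2016_closing_le_two_thirds`** — `3 · #closingWalks d n ≤ 2 · cₙ`, and its probability form
  **`DGHM2016_closingProb_le_two_thirds`** — `#closingWalks d n / cₙ ≤ 2/3`, verbatim the printed bound.

The proof is the printed one: (i) `exists_two_le_abs_apply` — an `n`-step self-avoiding walk with
`n ≥ 3^d` visits `n + 1 > 3^d` distinct sites, so it leaves the cube `{-1,0,1}^d` ("an axial direction
in which `γ` has maximal coordinate at least two", up to sign); (ii) the symmetry `symWalk i s`
(`(k, j) ↦ s · ω_k(swap 0 i j)`, tree `signSwapWalk_mem_saws`) moves that signed direction to `+e_0`;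
(iii) the unfolding is the tree's `unfoldStep` — reflection of the tail after the LAST maximum of the
first coordinate; the source allows "any index `k`" attaining the maximum and uses the lexicographic
hanging point only later, so this is a printed choice, and it comes with the tree's decoder
`undoStep_unfoldStep` (the walk is recovered from its unfolding and the level `M` of the maximum);
(iv) `closingUnfold` = symmetry ∘ unfold ∘ symmetry changes only the `i`-th coordinate, and its
endpoint has `i`-th coordinate `s (2M - s γ_n(i))` of modulus `t ≥ 3` while the others stay in
`{-1,0,1}`: the image is NOT closing (`closingUnfold_not_mem`), and `i`, `s` are read off the image
endpoint (`readDir`, `readSign`); (v) the level is `M = (t + e)/2` with `e ∈ {0,1}` ("at most two are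
integers"), so `closingDecode` recovers `γ` from `(closingUnfold γ, e)` (`exists_closingDecode_eq`), whence
`#closing ≤ 2 · #(non-closing)` — the multi-valued map principle of §2.2 in its simplest form — and
`3 · #closing ≤ 2 cₙ`.

No new definition of mathematical content: `unitCube`, `symWalk`, `readDir`, `readSign`,
`closingUnfold`, `closingDecode` are proof devices (the printed maps), kept public only so that the
intermediate statements can be cited by the sequel (a quantitative version would reuse them).
-/

noncomputable section

open Finset Literature.Probability.LatticeModels Literature.Probability.Percolation SimpleGraph
open scoped BigOperators

namespace Literature.Probability.RandomPlanarGeometry.SAW.Zd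

variable {d : ℕ} [NeZero d]

/-! ### (i) A long self-avoiding walk leaves the cube `{-1,0,1}^d` -/

/-- The cube `{-1,0,1}^d ⊆ ℤ^d` (the sites all of whose coordinates have modulus `≤ 1`).
[cite: DuminilCopinGlazmanHammondManolescu2016, §2.3 ("for all n ≥ 3^d + 1")] -/
def unitCube (d : ℕ) : Finset (Site d) :=
  Fintype.piFinset fun _ => Finset.Icc (-1 : ℤ) 1

/-- `#{-1,0,1}^d = 3^d`. [cite: DuminilCopinGlazmanHammondManolescu2016, §2.3] -/
theorem card_unitCube (d : ℕ) : (unitCube d).card = 3 ^ d := by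
  rw [unitCube, Fintype.card_piFinset]
  simp

omit [NeZero d] in
/-- Membership in the cube: every coordinate has modulus `≤ 1`.
[cite: DuminilCopinGlazmanHammondManolescu2016, §2.3] -/
theorem mem_unitCube {x : Site d} : x ∈ unitCube d ↔ ∀ j, |x j| ≤ 1 := by
  simp only [unitCube, Fintype.mem_piFinset, Finset.mem_Icc, abs_le]

omit [NeZero d] in
/-- **Pigeonhole**: an `n`-step self-avoiding walk with `n ≥ 3^d` has a site with a coordinate of
modulus `≥ 2` ("choose an axial direction in which `γ` has maximal coordinate at least two", up to a
sign). [cite: DuminilCopinGlazmanHammondManolescu2016, §2.3] -/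
theorem exists_two_le_abs_apply {n : ℕ} {ω : ℕ → Site d} (hω : ω ∈ saws d n) (hn : 3 ^ d ≤ n) :
    ∃ k ≤ n, ∃ j : Fin d, 2 ≤ |ω k j| := by
  classical
  by_contra h
  push Not at h
  obtain ⟨-, -, -, hinj⟩ := mem_saws.1 hω
  have hsub : (Finset.range (n + 1)).image ω ⊆ unitCube d := by
    intro x hx
    obtain ⟨k, hk, rfl⟩ := Finset.mem_image.1 hx
    have hk' : k ≤ n := Nat.le_of_lt_succ (Finset.mem_range.1 hk)
    exact mem_unitCube.2 fun j => by have := h k hk' j; omega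
  have hcard : ((Finset.range (n + 1)).image ω).card = n + 1 := by
    rw [Finset.card_image_of_injOn, Finset.card_range]
    intro a ha b hb hab
    exact hinj (Nat.le_of_lt_succ (Finset.mem_range.1 ha)) (Nat.le_of_lt_succ (Finset.mem_range.1 hb)) hab
  have := Finset.card_le_card hsub
  rw [hcard, card_unitCube] at this
  omega

/-! ### (ii) The hyperoctahedral symmetry moving the signed direction `(i, s)` to `+e_0` -/

/-- `symWalk i s ω`: swap the coordinates `0` and `i` and multiply by the sign `s` (at every time);
the tree's `signSwapWalk`. [cite: DuminilCopinGlazmanHammondManolescu2016, §2.3 ("we will assume this to be the e_1-direction")] -/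
def symWalk (i : Fin d) (s : ℤ) (ω : ℕ → Site d) : ℕ → Site d :=
  fun k j => s * ω k (Equiv.swap 0 i j)

/-- Coordinates of the symmetric walk. [cite: DuminilCopinGlazmanHammondManolescu2016, §2.3] -/
@[simp] theorem symWalk_apply (i : Fin d) (s : ℤ) (ω : ℕ → Site d) (k : ℕ) (j : Fin d) :
    symWalk i s ω k j = s * ω k (Equiv.swap 0 i j) := rfl

/-- The new first coordinate is `s` times the old `i`-th coordinate.
[cite: DuminilCopinGlazmanHammondManolescu2016, §2.3] -/
theorem symWalk_apply_zero (i : Fin d) (s : ℤ) (ω : ℕ → Site d) (k : ℕ) :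
    symWalk i s ω k 0 = s * ω k i := by
  rw [symWalk_apply, Equiv.swap_apply_left]

/-- For a sign `s = ±1` the symmetry is an involution. [cite: DuminilCopinGlazmanHammondManolescu2016, §2.3] -/
theorem symWalk_symWalk (i : Fin d) {s : ℤ} (hs : s = 1 ∨ s = -1) (ω : ℕ → Site d) :
    symWalk i s (symWalk i s ω) = ω := by
  funext k j
  simp only [symWalk_apply, Equiv.swap_apply_self]
  rcases hs with rfl | rfl <;> ring

/-- The symmetry preserves `n`-step self-avoiding walks from `0` (tree `signSwapWalk_mem_saws`).
[cite: DuminilCopinGlazmanHammondManolescu2016, §2.3] -/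
theorem symWalk_mem_saws {n : ℕ} {ω : ℕ → Site d} (hω : ω ∈ saws d n) (i : Fin d) {s : ℤ}
    (hs : s = 1 ∨ s = -1) : symWalk i s ω ∈ saws d n :=
  signSwapWalk_mem_saws hω i hs

/-! ### Closing walks have all endpoint coordinates in `{-1,0,1}` -/

omit [NeZero d] in
/-- A site of Euclidean norm `1` has every coordinate of modulus `≤ 1`.
[cite: DuminilCopinGlazmanHammondManolescu2016, §1.1 ("‖u‖ denote the Euclidean norm")] -/
theorem abs_apply_le_one_of_euclidNorm_eq_one {x : Site d} (hx : euclidNorm x = 1) (j : Fin d) :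
    |x j| ≤ 1 := by
  have hsq : ∑ i, ((x i : ℝ)) ^ 2 = 1 := by
    have := sq_euclidNorm x
    rw [hx, one_pow] at this
    exact this.symm
  have hj : ((x j : ℝ)) ^ 2 ≤ 1 := by
    calc ((x j : ℝ)) ^ 2 ≤ ∑ i, ((x i : ℝ)) ^ 2 :=
          Finset.single_le_sum (f := fun i => ((x i : ℝ)) ^ 2) (fun i _ => sq_nonneg _)
            (Finset.mem_univ j)
      _ = 1 := hsq
  have hj' : ((x j : ℤ) : ℝ) ^ 2 ≤ 1 := hj
  have hint : (x j) ^ 2 ≤ 1 := by exact_mod_cast hj'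
  exact abs_le_one_iff_mul_self_le_one.2 (by nlinarith [hint])

omit [NeZero d] in
/-- Endpoint coordinates of a closing walk lie in `{-1,0,1}`.
[cite: DuminilCopinGlazmanHammondManolescu2016, §2.3 ("‖γ_n‖ = 1")] -/
theorem abs_apply_le_one_of_mem_closingWalks {n : ℕ} {ω : ℕ → Site d} (hω : ω ∈ closingWalks d n)
    (j : Fin d) : |ω n j| ≤ 1 :=
  abs_apply_le_one_of_euclidNorm_eq_one (mem_closingWalks.1 hω).2 j

/-! ### (iii)–(iv) The unfolding of a closing walk in its signed direction -/

open Classical in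
/-- The signed direction `(i, s)` of a walk: some coordinate `i` and sign `s` with `s · ω_k(i) ≥ 2` at
some time `k ≤ n` (and `(0, 1)` if there is none). [cite: DuminilCopinGlazmanHammondManolescu2016, §2.3 ("choose an axial direction in which γ has maximal coordinate at least two")] -/
def dirSign (n : ℕ) (ω : ℕ → Site d) : Fin d × ℤ :=
  if h : ∃ p : ℕ × Fin d, p.1 ≤ n ∧ 2 ≤ |ω p.1 p.2| then
    ((Classical.choose h).2,
      if 0 ≤ ω (Classical.choose h).1 (Classical.choose h).2 then 1 else -1)
  else (0, 1)

/-- The chosen sign is `±1`. [cite: DuminilCopinGlazmanHammondManolescu2016, §2.3] -/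
theorem dirSign_snd_eq (n : ℕ) (ω : ℕ → Site d) : (dirSign n ω).2 = 1 ∨ (dirSign n ω).2 = -1 := by
  classical
  unfold dirSign
  split_ifs <;> simp

/-- If some coordinate reaches modulus `2`, the chosen signed coordinate reaches `2`:
`s · ω_k(i) ≥ 2` for some `k ≤ n`. [cite: DuminilCopinGlazmanHammondManolescu2016, §2.3] -/
theorem exists_two_le_dirSign {n : ℕ} {ω : ℕ → Site d} (h : ∃ k ≤ n, ∃ j : Fin d, 2 ≤ |ω k j|) :
    ∃ k ≤ n, 2 ≤ (dirSign n ω).2 * ω k (dirSign n ω).1 := by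
  have h' : ∃ p : ℕ × Fin d, p.1 ≤ n ∧ 2 ≤ |ω p.1 p.2| := by
    obtain ⟨k, hk, j, hj⟩ := h
    exact ⟨(k, j), hk, hj⟩
  have hspec := Classical.choose_spec h'
  refine ⟨(Classical.choose h').1, hspec.1, ?_⟩
  classical
  unfold dirSign
  rw [dif_pos h']
  split_ifs with hnn
  · rw [abs_of_nonneg hnn] at hspec; linarith [hspec.2]
  · rw [abs_of_neg (lt_of_not_ge hnn)] at hspec; linarith [hspec.2]

/-- **The unfolding of §2.3** (in the signed direction `(i, s)`): move `(i, s)` to `+e_0`, reflect the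
tail after the last maximum of the first coordinate (tree `unfoldStep`), move back.
[cite: DuminilCopinGlazmanHammondManolescu2016, §2.3 ("associate to γ its simple unfolding b ∈ SAW_n")] -/
def closingUnfold (n : ℕ) (ω : ℕ → Site d) : ℕ → Site d :=
  symWalk (dirSign n ω).1 (dirSign n ω).2
    (unfoldStep n (symWalk (dirSign n ω).1 (dirSign n ω).2 ω))

/-- The unfolding is an `n`-step self-avoiding walk ("the condition on `k` ensures that any such walk
is indeed self-avoiding"). [cite: DuminilCopinGlazmanHammondManolescu2016, §2.3] -/
theorem closingUnfold_mem_saws {n : ℕ} {ω : ℕ → Site d} (hω : ω ∈ saws d n) :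
    closingUnfold n ω ∈ saws d n :=
  symWalk_mem_saws (unfoldStep_mem_saws (symWalk_mem_saws hω _ (dirSign_snd_eq n ω))) _
    (dirSign_snd_eq n ω)

/-- The unfolding changes only the `i`-th coordinate.
[cite: DuminilCopinGlazmanHammondManolescu2016, §2.3] -/
theorem closingUnfold_apply_of_ne (n : ℕ) (ω : ℕ → Site d) (k : ℕ) {j : Fin d}
    (hj : j ≠ (dirSign n ω).1) : closingUnfold n ω k j = ω k j := by
  have hne : Equiv.swap (0 : Fin d) (dirSign n ω).1 j ≠ 0 := by
    intro h0
    rw [Equiv.swap_apply_eq_iff, Equiv.swap_apply_left] at h0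
    exact hj h0
  rw [closingUnfold, symWalk_apply, unfoldStep_apply_of_ne _ _ _ hne, symWalk_apply, Equiv.swap_apply_self,
    ← mul_assoc]
  rcases dirSign_snd_eq n ω with h | h <;> rw [h] <;> ring

/-- Quantities of the unfolding of a CLOSING walk `ω` with `n ≥ 3^d + 1`, in the frame `ψ = symWalk i s ω`:
the level `M = maxLevel n ψ ≥ 2`, the old endpoint height `v = ψ_n(0) = s ω_n(i) ∈ {-1,0,1}`, the
maximum is NOT attained at the end (`lastArgmax n ψ < n`), and the new `i`-th endpoint coordinate is
`s (2M - v)`. [cite: DuminilCopinGlazmanHammondManolescu2016, §2.3 ("the level at which the unfolding was done")] -/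
theorem closingUnfold_endpoint {n : ℕ} {ω : ℕ → Site d} (hω : ω ∈ closingWalks d n) (hn : 3 ^ d + 1 ≤ n) :
    2 ≤ maxLevel n (symWalk (dirSign n ω).1 (dirSign n ω).2 ω) ∧
    |symWalk (dirSign n ω).1 (dirSign n ω).2 ω n 0| ≤ 1 ∧
    lastArgmax n (symWalk (dirSign n ω).1 (dirSign n ω).2 ω) < n ∧
    closingUnfold n ω n (dirSign n ω).1 =
      (dirSign n ω).2 * (2 * maxLevel n (symWalk (dirSign n ω).1 (dirSign n ω).2 ω) -
        symWalk (dirSign n ω).1 (dirSign n ω).2 ω n 0) := by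
  have hs := dirSign_snd_eq n ω
  set i := (dirSign n ω).1 with hi_def
  set s := (dirSign n ω).2 with hs_def
  set ψ := symWalk i s ω with hψ
  have hsaw := (mem_closingWalks.1 hω).1
  -- the level is ≥ 2
  have hM : 2 ≤ maxLevel n ψ := by
    obtain ⟨k, hk, h2⟩ := exists_two_le_dirSign (exists_two_le_abs_apply hsaw (by omega))
    calc (2 : ℤ) ≤ s * ω k i := h2
      _ = ψ k 0 := (symWalk_apply_zero i s ω k).symm
      _ ≤ maxLevel n ψ := apply_le_maxLevel ψ hk
  -- the old endpoint height is in {-1,0,1}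
  have hv : |ψ n 0| ≤ 1 := by
    rw [hψ, symWalk_apply_zero]
    have := abs_apply_le_one_of_mem_closingWalks hω i
    rcases hs with h | h <;> simp [h, this, abs_neg]
  -- hence the maximum is not attained at the end
  have hlast : lastArgmax n ψ < n := by
    obtain ⟨hle, heq⟩ := lastArgmax_spec n ψ
    refine lt_of_le_of_ne hle fun h => ?_
    rw [h] at heq
    have := (abs_le.1 hv).2
    omega
  refine ⟨hM, hv, hlast, ?_⟩
  rw [closingUnfold, ← hi_def, ← hs_def, symWalk_apply, Equiv.swap_apply_right, ← hψ,
    unfoldStep_apply_zero, if_neg (Nat.not_le.2 hlast)]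

/-- The unfolding of a closing walk is NOT closing: its `i`-th endpoint coordinate has modulus
`2M - v ≥ 3` ("since the maximal `e_1`-coordinate of `γ` is at least two, the unfolding of `γ` is such
that `‖b_n‖ > 1`"). [cite: DuminilCopinGlazmanHammondManolescu2016, §2.3] -/
theorem three_le_abs_closingUnfold {n : ℕ} {ω : ℕ → Site d} (hω : ω ∈ closingWalks d n)
    (hn : 3 ^ d + 1 ≤ n) : 3 ≤ |closingUnfold n ω n (dirSign n ω).1| := by
  obtain ⟨hM, hv, -, hend⟩ := closingUnfold_endpoint hω hn
  rw [hend, abs_mul]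
  have hs := dirSign_snd_eq n ω
  have h1 : |(dirSign n ω).2| = 1 := by rcases hs with h | h <;> simp [h]
  rw [h1, one_mul]
  have := (abs_le.1 hv).2
  rw [abs_of_nonneg (by omega)]
  omega

/-- Hence the unfolding of a closing walk is a non-closing `n`-step self-avoiding walk.
[cite: DuminilCopinGlazmanHammondManolescu2016, §2.3 ("‖b_n‖ > 1")] -/
theorem closingUnfold_not_mem {n : ℕ} {ω : ℕ → Site d} (hω : ω ∈ closingWalks d n) (hn : 3 ^ d + 1 ≤ n) :
    closingUnfold n ω ∉ closingWalks d n := fun h => by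
  have h1 := abs_apply_le_one_of_mem_closingWalks h (dirSign n ω).1
  have h3 := three_le_abs_closingUnfold hω hn
  omega

/-! ### (v) Reading the direction, the sign and the level off the unfolded walk -/

/-- The direction read off a walk `φ`: a coordinate of `φ_n` of modulus `≥ 2` (or `0`).
[cite: DuminilCopinGlazmanHammondManolescu2016, §2.3 ("the choice of axial direction … may be determined from the unfolded walk")] -/
def readDir (n : ℕ) (φ : ℕ → Site d) : Fin d :=
  if h : ∃ j : Fin d, 2 ≤ |φ n j| then Classical.choose h else 0

/-- The sign read off `φ`: the sign of the endpoint coordinate in the read direction.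
[cite: DuminilCopinGlazmanHammondManolescu2016, §2.3] -/
def readSign (n : ℕ) (φ : ℕ → Site d) : ℤ :=
  if 0 ≤ φ n (readDir n φ) then 1 else -1

/-- **The decoder**: from an unfolded walk `φ` and a bit `e`, read `(i, s)` off the endpoint, take the
level `M = (|φ_n(i)| + e)/2`, and fold back (tree `undoStep`) in the frame of `+e_0`.
[cite: DuminilCopinGlazmanHammondManolescu2016, §2.3 ("the level at which the unfolding was done is one among (⟨b_n|e_1⟩-1)/2, ⟨b_n|e_1⟩/2, (⟨b_n|e_1⟩+1)/2, of which at most two are integers")] -/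
def closingDecode (n : ℕ) (φ : ℕ → Site d) (e : ℕ) : ℕ → Site d :=
  symWalk (readDir n φ) (readSign n φ)
    (undoStep n (symWalk (readDir n φ) (readSign n φ) φ) ((|φ n (readDir n φ)| + e) / 2))

/-- The direction is read correctly off the unfolding of a closing walk (it is the unique coordinate of
the endpoint of modulus `≥ 2`). [cite: DuminilCopinGlazmanHammondManolescu2016, §2.3] -/
theorem readDir_closingUnfold {n : ℕ} {ω : ℕ → Site d} (hω : ω ∈ closingWalks d n) (hn : 3 ^ d + 1 ≤ n) :
    readDir n (closingUnfold n ω) = (dirSign n ω).1 := by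
  have hex : ∃ j : Fin d, 2 ≤ |closingUnfold n ω n j| :=
    ⟨(dirSign n ω).1, le_trans (by norm_num) (three_le_abs_closingUnfold hω hn)⟩
  rw [readDir, dif_pos hex]
  have hspec := Classical.choose_spec hex
  by_contra hne
  rw [closingUnfold_apply_of_ne n ω n hne] at hspec
  have := abs_apply_le_one_of_mem_closingWalks hω (Classical.choose hex)
  omega

/-- The sign is read correctly off the unfolding of a closing walk.
[cite: DuminilCopinGlazmanHammondManolescu2016, §2.3] -/
theorem readSign_closingUnfold {n : ℕ} {ω : ℕ → Site d} (hω : ω ∈ closingWalks d n) (hn : 3 ^ d + 1 ≤ n) :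
    readSign n (closingUnfold n ω) = (dirSign n ω).2 := by
  obtain ⟨hM, hv, -, hend⟩ := closingUnfold_endpoint hω hn
  rw [readSign, readDir_closingUnfold hω hn, hend]
  have hpos : 0 < 2 * maxLevel n (symWalk (dirSign n ω).1 (dirSign n ω).2 ω) -
      symWalk (dirSign n ω).1 (dirSign n ω).2 ω n 0 := by
    have := (abs_le.1 hv).2; omega
  set X := 2 * maxLevel n (symWalk (dirSign n ω).1 (dirSign n ω).2 ω) -
      symWalk (dirSign n ω).1 (dirSign n ω).2 ω n 0 with hX
  rcases dirSign_snd_eq n ω with h | h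
  · have h1 : 0 ≤ (dirSign n ω).2 * X := by rw [h, one_mul]; exact hpos.le
    rw [if_pos h1, h]
  · have h1 : ¬ 0 ≤ (dirSign n ω).2 * X := by rw [h, neg_one_mul, not_le]; exact neg_neg_of_pos hpos
    rw [if_neg h1, h]

/-- **Decoding** ("any unfolded walk `b` corresponds to at most two walks `γ` with `‖γ_n‖ = 1`"): a
closing walk is recovered from its unfolding and one bit.
[cite: DuminilCopinGlazmanHammondManolescu2016, §2.3] -/
theorem exists_closingDecode_eq {n : ℕ} {ω : ℕ → Site d} (hω : ω ∈ closingWalks d n) (hn : 3 ^ d + 1 ≤ n) :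
    ∃ e < 2, closingDecode n (closingUnfold n ω) e = ω := by
  obtain ⟨hM, hv, -, hend⟩ := closingUnfold_endpoint hω hn
  have hs := dirSign_snd_eq n ω
  set i := (dirSign n ω).1 with hi_def
  set s := (dirSign n ω).2 with hs_def
  set ψ := symWalk i s ω with hψ
  set v := ψ n 0 with hv_def
  set M := maxLevel n ψ with hM_def
  -- the bit: `1` exactly when the old endpoint height is `+1` (then `t = 2M - 1` is odd from below)
  refine ⟨if v = 1 then 1 else 0, by split_ifs <;> norm_num, ?_⟩
  have habs : |closingUnfold n ω n i| = 2 * M - v := by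
    rw [hend, abs_mul]
    have h1 : |s| = 1 := by rcases hs with h | h <;> simp [h]
    rw [h1, one_mul, abs_of_nonneg]
    have := (abs_le.1 hv).2; omega
  have hlevel : (|closingUnfold n ω n i| + ((if v = 1 then 1 else 0 : ℕ) : ℤ)) / 2 = M := by
    rw [habs]
    obtain ⟨h1, h2⟩ := abs_le.1 hv
    split_ifs with h <;> push_cast <;> omega
  rw [closingDecode, readSign_closingUnfold hω hn, readDir_closingUnfold hω hn, ← hi_def, ← hs_def, hlevel]
  -- in the frame of `+e_0` the unfolding is the tree's `unfoldStep`, undone by `undoStep` at level `M`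
  have hframe : symWalk i s (closingUnfold n ω) = unfoldStep n ψ := by
    rw [closingUnfold, ← hi_def, ← hs_def, symWalk_symWalk i hs]
  rw [hframe, hM_def, undoStep_unfoldStep, hψ, symWalk_symWalk i hs]

/-! ### The bound -/

/-- **Duminil-Copin–Glazman–Hammond–Manolescu 2016, §2.3 (after Madras 2014)**, counting form: for
`n ≥ 3^d + 1`, `3 · #{γ ∈ SAW_n : ‖γ_n‖ = 1} ≤ 2 cₙ` — every closing walk is decoded from a non-closing
walk and one bit, so `#closing ≤ 2 · #non-closing`.
[cite: DuminilCopinGlazmanHammondManolescu2016, §2.3 ("P_{SAW_n}(‖Γ_n‖ = 1) ≤ 2/3 for all n ≥ 3^d + 1")] -/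
theorem DGHM2016_closing_le_two_thirds (n : ℕ) (hn : 3 ^ d + 1 ≤ n) :
    3 * (closingWalks d n).card ≤ 2 * count d n := by
  classical
  have hsub : closingWalks d n ⊆ saws d n := fun ω hω => (mem_closingWalks.1 hω).1
  have hsplit : (saws d n \ closingWalks d n).card + (closingWalks d n).card = count d n := by
    rw [← card_saws]; exact Finset.card_sdiff_add_card_eq_card hsub
  have hcover : closingWalks d n ⊆
      ((saws d n \ closingWalks d n) ×ˢ Finset.range 2).image fun p => closingDecode n p.1 p.2 := by
    intro ω hω
    obtain ⟨e, he, hdec⟩ := exists_closingDecode_eq hω hn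
    exact Finset.mem_image.2 ⟨(closingUnfold n ω, e), Finset.mem_product.2
      ⟨Finset.mem_sdiff.2 ⟨closingUnfold_mem_saws (hsub hω), closingUnfold_not_mem hω hn⟩,
        Finset.mem_range.2 he⟩, hdec⟩
  have hle := (Finset.card_le_card hcover).trans Finset.card_image_le
  rw [Finset.card_product, Finset.card_range] at hle
  omega

/-- **Duminil-Copin–Glazman–Hammond–Manolescu 2016, §2.3, AS PRINTED**: "`P_{SAW_n}(‖Γ_n‖ = 1) ≤ 2/3` for
all `n ≥ 3^d + 1`", the probability under the uniform law on `SAW_n` written as `#closingWalks d n / cₙ`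
(here for every `d ≥ 1`; the source has `d ≥ 2`).
[cite: DuminilCopinGlazmanHammondManolescu2016, §2.3] [cite: Madras2014, §2 (the unfolding technique adapted)] -/
theorem DGHM2016_closingProb_le_two_thirds (n : ℕ) (hn : 3 ^ d + 1 ≤ n) :
    ((closingWalks d n).card : ℝ) / (count d n : ℝ) ≤ 2 / 3 := by
  have hc : (0 : ℝ) < count d n := by exact_mod_cast one_le_count d n
  rw [div_le_div_iff₀ hc (by norm_num : (0 : ℝ) < 3)]
  have h := DGHM2016_closing_le_two_thirds (d := d) n hn
  have h' : ((3 * (closingWalks d n).card : ℕ) : ℝ) ≤ ((2 * count d n : ℕ) : ℝ) := by exact_mod_cast h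
  push_cast at h'
  linarith

end Literature.Probability.RandomPlanarGeometry.SAW.Zd

end
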